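/-
Copyright (c) 2026 the pub-hodgecm-mathlib formalisation cell (harness21).  Prover seat hodgecm-mathlib-K2E5-p16 (g5): Track B «K2-LIT»,
hLiu418 = stmt-HodgeConjecture-24832, ROAD Φ organ Φ6b-6 (β-shift of Shimura's `η` on `Herm₂(ℂ)`), file (3a): the one-variable
integration by parts on an `a`-fibre of the cone; 2026-09-04.
-/
import Mathlib.MeasureTheory.Integral.IntegralEqImproper
import Mathlib.Analysis.SpecialFunctions.Pow.Deriv
import Mathlib.Analysis.SpecialFunctions.Pow.Continuity
import Mathlib.Analysis.Complex.RealDeriv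
import HarnessLib

/-!
# Crux `HLiu418`, ROAD Φ, organ Φ6b-6 — file (3a): integration by parts on one fibre `a ∈ (|z|²∕b, ∞)`

Cell `hodgecm-mathlib`, crux item hLiu418 = `stmt-HodgeConjecture-24832`, route of record `HCCMUnconditional`; squad K2, LEAD F0P6-plan (g12)
(«= GO the first-order vehicle» 2026-09-04 07:40:27Z), co-dealer K2E5-plan (g6), prover K2E5-p16 (g5).  THEOREMS ONLY (no `def`, no instance,
no notation, no named-fact hypothesis, no `sorry`, default heartbeats); pure Mathlib; lane `--supports stmt-HodgeConjecture-24832 --as helper`.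

THE FIBRE.  In the chart `u = [[a, z],[z̄, b]]` of `Herm₂(ℂ)` the cone `{u > 0}` has, over a fixed `(z, b)` with `b > 0`, the `a`-fibre
`(m∕b, ∞)`, `m = |z|²`.  Along it the translated `η`-integrand `e^{−tr((u+h)g)} det(u + 2h)^{α−2} det(u)^{β−2}` reads, with REAL constants
`p = g₀₀ > 0`, `K₁`, `λ = b + 2h₁₁ ≥ 0`, `K₂` (so that `det(u + 2h) = aλ + K₂ > 0` on the closed fibre) :
  `U(a)·V′(a) ∕ (β − 1)` where `U(a) = e^{−(ap + K₁)} (aλ + K₂)^{α−2} ∕ b`, `V(a) = (ab − m)^{β−1}`, `V′ = (β−1)·b·(ab − m)^{β−2}`,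
and `U′ = U·(−p + (α−2)λ∕(aλ + K₂))`, so that `−U′V = Q_α · e^{−(ap+K₁)}(aλ+K₂)^{α−2}(ab − m)^{β−1}` with the WEIGHT
`Q_α = (p − (α−2)λ∕(aλ+K₂))∕b` of ★ `K2LiuHermTwoEtaShiftDefs.etaShiftWeight`.
* `hasDerivAt_fibreU`, `hasDerivAt_fibreV` — the two derivatives (★ Mathlib `HasDerivAt.cpow_const`, `HasDerivAt.comp_ofReal`);
* `tendsto_fibreV_zero` — `V(a) → 0` as `a ↓ m∕b` (`re β > 1`; ★ `continuous_ofReal_cpow_const`);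
* `fibre_integral_byParts` — THE FIBRE IDENTITY `∫_{a > m∕b} (β−1)·e^{−(ap+K₁)}(aλ+K₂)^{α−2}(ab−m)^{β−2} da
  = ∫_{a > m∕b} Q_α(a)·e^{−(ap+K₁)}(aλ+K₂)^{α−2}(ab−m)^{(β+1)−2} da`, GIVEN the integrability of the three fibre functions `UV′`, `U′V`, `UV` on the
  fibre (★ Mathlib `integral_Ioi_mul_deriv_eq_deriv_mul`; the boundary term at `m∕b` vanishes because `V → 0` and `U` is continuous there, the one at
  `∞` because `UV` and `(UV)′` are integrable, ★ `tendsto_zero_of_hasDerivAt_of_integrableOn_Ioi` — no growth estimate needed).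
File (3b) `K2LiuHermTwoEtaBetaShift` supplies the three integrability hypotheses for a.e. fibre (Fubini) and assembles `(β−1)·η = etaShift`.
HONEST LABEL.  Count-neutral helper of the K2_Liu road; it pays no socket by itself: `HC_CM` is proved only modulo the 7 printed citations
(2 remaining named inputs: hLiu418 = `stmt-HodgeConjecture-24832`, h413 = `stmt-HodgeConjecture-24833`) until rung 0 closes.
-/

set_option autoImplicit false
-- the mandated namespace repeats the single-problem summit's segment (`HodgeConjecture.HodgeConjecture`)
set_option linter.dupNamespace false

noncomputable section

open Complex MeasureTheory Set Filter Topology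

namespace Summit.HodgeConjecture.HodgeConjecture.Cruxes.HLiu418.K2LiuHermTwoEtaShiftFibre

/-! ## The two fibre functions and their derivatives -/

/-- `U(a) = e^{−(ap + K₁)} (aλ + K₂)^{α−2} ∕ b` has, where `aλ + K₂ > 0`, the derivative `U(a)·(−p + (α − 2)·λ∕(aλ + K₂))`. -/
theorem hasDerivAt_fibreU (p K₁ lam K₂ b : ℝ) (α : ℂ) {a : ℝ} (hP : 0 < a * lam + K₂) :
    HasDerivAt (fun a : ℝ => cexp (-((a : ℂ) * p + K₁)) * ((a : ℂ) * lam + K₂) ^ (α - 2) / b)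
      (cexp (-((a : ℂ) * p + K₁)) * ((a : ℂ) * lam + K₂) ^ (α - 2) / b * (-(p : ℂ) + (α - 2) * ((lam : ℂ) / ((a : ℂ) * lam + K₂)))) a := by
  have hX : ((a : ℂ) * lam + K₂) = ((a * lam + K₂ : ℝ) : ℂ) := by push_cast; ring
  have hX0 : ((a : ℂ) * lam + K₂) ≠ 0 := by
    rw [hX]
    exact ofReal_ne_zero.mpr hP.ne'
  have hXs : ((a : ℂ) * lam + K₂) ∈ slitPlane := by
    rw [hX]
    exact ofReal_mem_slitPlane.mpr hP
  -- the complex-variable function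
  have h1 : HasDerivAt (fun ζ : ℂ => cexp (-(ζ * p + K₁))) (cexp (-((a : ℂ) * p + K₁)) * (-(p : ℂ))) (a : ℂ) := by
    have h := (((hasDerivAt_id (a : ℂ)).mul_const (p : ℂ)).add_const (K₁ : ℂ)).neg.cexp
    simpa using h
  have h2 : HasDerivAt (fun ζ : ℂ => (ζ * lam + K₂) ^ (α - 2)) ((α - 2) * ((a : ℂ) * lam + K₂) ^ (α - 2 - 1) * (lam : ℂ)) (a : ℂ) := by
    have h := (((hasDerivAt_id (a : ℂ)).mul_const (lam : ℂ)).add_const (K₂ : ℂ)).cpow_const (c := α - 2) hXs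
    simpa using h
  have h3 := ((h1.mul h2).div_const (b : ℂ)).comp_ofReal
  refine h3.congr_deriv ?_
  have hsub : ((a : ℂ) * lam + K₂) ^ (α - 2 - 1) = ((a : ℂ) * lam + K₂) ^ (α - 2) / ((a : ℂ) * lam + K₂) := by
    rw [cpow_sub (α - 2) 1 hX0, cpow_one]
  rw [hsub]
  field_simp

/-- `V(a) = (ab − m)^{β−1}` has, where `ab − m > 0`, the derivative `(β − 1)·(ab − m)^{β−2}·b`. -/
theorem hasDerivAt_fibreV (b m : ℝ) (β : ℂ) {a : ℝ} (hY : 0 < a * b - m) :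
    HasDerivAt (fun a : ℝ => ((a : ℂ) * b - m) ^ (β - 1)) ((β - 1) * ((a : ℂ) * b - m) ^ (β - 2) * b) a := by
  have hY' : ((a : ℂ) * b - m) = ((a * b - m : ℝ) : ℂ) := by push_cast; ring
  have hYs : ((a : ℂ) * b - m) ∈ slitPlane := by
    rw [hY']
    exact ofReal_mem_slitPlane.mpr hY
  have h := ((((hasDerivAt_id (a : ℂ)).mul_const (b : ℂ)).sub_const (m : ℂ)).cpow_const (c := β - 1) hYs).comp_ofReal
  refine h.congr_deriv ?_
  rw [show β - 1 - 1 = β - 2 by ring]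
  simp

/-- `V(a) = (ab − m)^{β−1} → 0` as `a ↓ m∕b` (`b > 0`, `re β > 1`): the boundary term at the finite end of the fibre vanishes. -/
theorem tendsto_fibreV_zero {b : ℝ} (hb : 0 < b) (m : ℝ) {β : ℂ} (hβ : 1 < β.re) :
    Tendsto (fun a : ℝ => ((a : ℂ) * b - m) ^ (β - 1)) (𝓝[>] (m / b)) (𝓝 0) := by
  have hre : 0 < (β - 1).re := by simp only [sub_re, one_re]; linarith
  have hcont : Continuous fun a : ℝ => (((a * b - m : ℝ) : ℂ)) ^ (β - 1) :=
    (continuous_ofReal_cpow_const hre).comp (by fun_prop)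
  have hval : (((m / b * b - m : ℝ) : ℂ)) ^ (β - 1) = 0 := by
    rw [div_mul_cancel₀ m hb.ne', sub_self, ofReal_zero, zero_cpow]
    intro h0
    rw [h0, zero_re] at hre
    exact lt_irrefl 0 hre
  have h := (hcont.tendsto (m / b)).mono_left (nhdsWithin_le_nhds (s := Ioi (m / b)))
  rw [hval] at h
  refine h.congr fun a => ?_
  push_cast
  ring_nf

/-! ## The fibre identity -/

/-- **INTEGRATION BY PARTS ON ONE FIBRE** (organ Φ6b-6, file (3a)).  Let `b > 0`, `λ ≥ 0`, `(m∕b)λ + K₂ > 0` (so `aλ + K₂ > 0` on the closed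
fibre `a ≥ m∕b`), `α ∈ ℂ`, `re β > 1`, and suppose the three fibre functions
`(β−1)·e^{−(ap+K₁)}(aλ+K₂)^{α−2}(ab−m)^{β−2}` (`= UV′`), `Q_α(a)·e^{−(ap+K₁)}(aλ+K₂)^{α−2}(ab−m)^{(β+1)−2}` (`= −U′V`) and
`b⁻¹·e^{−(ap+K₁)}(aλ+K₂)^{α−2}(ab−m)^{(β+1)−2}` (`= UV`) are integrable on `(m∕b, ∞)`.  Then
`∫_{a > m∕b} (β−1)·e^{−(ap+K₁)}(aλ+K₂)^{α−2}(ab−m)^{β−2} da = ∫_{a > m∕b} Q_α(a)·e^{−(ap+K₁)}(aλ+K₂)^{α−2}(ab−m)^{(β+1)−2} da`,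
`Q_α(a) = (p − (α−2)λ∕(aλ+K₂))∕b`. -/
theorem fibre_integral_byParts {p K₁ lam K₂ b m : ℝ} (hb : 0 < b) (hlam : 0 ≤ lam) (hP₀ : 0 < m / b * lam + K₂) (α : ℂ) {β : ℂ}
    (hβ : 1 < β.re)
    (h1 : IntegrableOn (fun a : ℝ => (β - 1) *
      (cexp (-((a : ℂ) * p + K₁)) * (((a : ℂ) * lam + K₂) ^ (α - 2) * ((a : ℂ) * b - m) ^ (β - 2)))) (Ioi (m / b)))
    (h2 : IntegrableOn (fun a : ℝ => ((p : ℂ) - (α - 2) * ((lam : ℂ) / ((a : ℂ) * lam + K₂))) / b *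
      (cexp (-((a : ℂ) * p + K₁)) * (((a : ℂ) * lam + K₂) ^ (α - 2) * ((a : ℂ) * b - m) ^ (β + 1 - 2)))) (Ioi (m / b)))
    (h3 : IntegrableOn (fun a : ℝ => ((b : ℂ))⁻¹ *
      (cexp (-((a : ℂ) * p + K₁)) * (((a : ℂ) * lam + K₂) ^ (α - 2) * ((a : ℂ) * b - m) ^ (β + 1 - 2)))) (Ioi (m / b))) :
    ∫ a in Ioi (m / b), (β - 1) * (cexp (-((a : ℂ) * p + K₁)) * (((a : ℂ) * lam + K₂) ^ (α - 2) * ((a : ℂ) * b - m) ^ (β - 2))) =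
      ∫ a in Ioi (m / b), ((p : ℂ) - (α - 2) * ((lam : ℂ) / ((a : ℂ) * lam + K₂))) / b *
        (cexp (-((a : ℂ) * p + K₁)) * (((a : ℂ) * lam + K₂) ^ (α - 2) * ((a : ℂ) * b - m) ^ (β + 1 - 2))) := by
  have hb0 : (b : ℂ) ≠ 0 := ofReal_ne_zero.mpr hb.ne'
  -- positivity on the fibre
  have hPos : ∀ a ∈ Ioi (m / b), 0 < a * lam + K₂ ∧ 0 < a * b - m := by
    intro a ha
    have ha' : m / b < a := ha
    refine ⟨?_, ?_⟩
    · have : m / b * lam ≤ a * lam := mul_le_mul_of_nonneg_right ha'.le hlam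
      linarith
    · have : m < a * b := (div_lt_iff₀ hb).mp ha'
      linarith
  -- the four functions
  set U : ℝ → ℂ := fun a => cexp (-((a : ℂ) * p + K₁)) * ((a : ℂ) * lam + K₂) ^ (α - 2) / b with hU
  set U' : ℝ → ℂ := fun a => cexp (-((a : ℂ) * p + K₁)) * ((a : ℂ) * lam + K₂) ^ (α - 2) / b *
    (-(p : ℂ) + (α - 2) * ((lam : ℂ) / ((a : ℂ) * lam + K₂))) with hU'
  set V : ℝ → ℂ := fun a => ((a : ℂ) * b - m) ^ (β - 1) with hV
  set V' : ℝ → ℂ := fun a => (β - 1) * ((a : ℂ) * b - m) ^ (β - 2) * b with hV'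
  have hu : ∀ a ∈ Ioi (m / b), HasDerivAt U (U' a) a := fun a ha => hasDerivAt_fibreU p K₁ lam K₂ b α (hPos a ha).1
  have hv : ∀ a ∈ Ioi (m / b), HasDerivAt V (V' a) a := fun a ha => hasDerivAt_fibreV b m β (hPos a ha).2
  -- the three products, pointwise
  have hUV' : ∀ a : ℝ, U a * V' a =
      (β - 1) * (cexp (-((a : ℂ) * p + K₁)) * (((a : ℂ) * lam + K₂) ^ (α - 2) * ((a : ℂ) * b - m) ^ (β - 2))) := by
    intro a
    simp only [hU, hV']
    field_simp
  have hU'V : ∀ a : ℝ, U' a * V a =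
      -(((p : ℂ) - (α - 2) * ((lam : ℂ) / ((a : ℂ) * lam + K₂))) / b *
        (cexp (-((a : ℂ) * p + K₁)) * (((a : ℂ) * lam + K₂) ^ (α - 2) * ((a : ℂ) * b - m) ^ (β + 1 - 2)))) := by
    intro a
    simp only [hU', hV]
    rw [show β + 1 - 2 = β - 1 by ring]
    ring
  have hUV : ∀ a : ℝ, U a * V a =
      ((b : ℂ))⁻¹ * (cexp (-((a : ℂ) * p + K₁)) * (((a : ℂ) * lam + K₂) ^ (α - 2) * ((a : ℂ) * b - m) ^ (β + 1 - 2))) := by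
    intro a
    simp only [hU, hV]
    rw [show β + 1 - 2 = β - 1 by ring]
    field_simp
  -- integrability of the products
  have huv' : IntegrableOn (U * V') (Ioi (m / b)) := by
    refine h1.congr_fun (fun a _ => ?_) measurableSet_Ioi
    simp only [Pi.mul_apply, hUV']
  have hu'v : IntegrableOn (U' * V) (Ioi (m / b)) := by
    refine h2.neg.congr_fun (fun a _ => ?_) measurableSet_Ioi
    simp only [Pi.mul_apply, Pi.neg_apply, hU'V]
  have huv : IntegrableOn (U * V) (Ioi (m / b)) := by
    refine h3.congr_fun (fun a _ => ?_) measurableSet_Ioi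
    simp only [Pi.mul_apply, hUV]
  -- the boundary term at `m/b`: `U` continuous, `V → 0`
  have h_zero : Tendsto (U * V) (𝓝[>] (m / b)) (𝓝 0) := by
    have hUc : Tendsto U (𝓝[>] (m / b)) (𝓝 (U (m / b))) :=
      ((hasDerivAt_fibreU p K₁ lam K₂ b α (a := m / b) hP₀).continuousAt.tendsto).mono_left nhdsWithin_le_nhds
    have hVc : Tendsto V (𝓝[>] (m / b)) (𝓝 0) := tendsto_fibreV_zero hb m hβ
    have h := hUc.mul hVc
    rw [mul_zero] at h
    exact h
  -- the boundary term at `∞`: `UV` and `(UV)′` integrable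
  have h_infty : Tendsto (U * V) atTop (𝓝 0) := by
    refine tendsto_zero_of_hasDerivAt_of_integrableOn_Ioi (a := m / b) (f' := fun a => U' a * V a + U a * V' a)
      (fun a ha => (hu a ha).mul (hv a ha)) ?_ huv
    exact hu'v.add huv'
  -- integrate by parts
  have hIBP := integral_Ioi_mul_deriv_eq_deriv_mul hu hv huv' hu'v h_zero h_infty
  rw [sub_zero, zero_sub, ← integral_neg] at hIBP
  calc ∫ a in Ioi (m / b), (β - 1) * (cexp (-((a : ℂ) * p + K₁)) * (((a : ℂ) * lam + K₂) ^ (α - 2) * ((a : ℂ) * b - m) ^ (β - 2)))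
      = ∫ a in Ioi (m / b), U a * V' a := setIntegral_congr_fun measurableSet_Ioi fun a _ => (hUV' a).symm
    _ = ∫ a in Ioi (m / b), -(U' a * V a) := hIBP
    _ = ∫ a in Ioi (m / b), ((p : ℂ) - (α - 2) * ((lam : ℂ) / ((a : ℂ) * lam + K₂))) / b *
          (cexp (-((a : ℂ) * p + K₁)) * (((a : ℂ) * lam + K₂) ^ (α - 2) * ((a : ℂ) * b - m) ^ (β + 1 - 2))) :=
        setIntegral_congr_fun measurableSet_Ioi fun a _ => by rw [hU'V, neg_neg]

end Summit.HodgeConjecture.HodgeConjecture.Cruxes.HLiu418.K2LiuHermTwoEtaShiftFibre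

end
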